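import Summits.BirchSwinnertonDyer.BirchSwinnertonDyer.Theorems.MordellShaFreeCutRungDVSquare

set_option linter.dupNamespace false
set_option autoImplicit false

/-! # Route `MordellShaFreeCut` (rung S2b) — registered stub `stub_rung_dvSquare` of crux
`RankPosOfThreeSelmerCorankOne` (stmt-BirchSwinnertonDyer-19159, the route's declared RESIDUAL conjunct)

STUB CREDIT ALIAS (3 lines). The theorem `MordellShaFreeCutRungDVSquare.rung_dvSquare_pow_four`
(p425273, prover bsd-cn100-s2b-c3 g2; core `rung_dvSquare` p424796) is crux A VERBATIM restricted to
the Dasgupta–Voight SQUARE family `D = −432 p⁴` (`x³ + y³ = p²`; `p ≡ 4, 7 (mod 9)` prime, `3` not a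
cube mod `p`) modulo the ONE refereed fact
`Literature.NumberTheory.EllipticCurves.DasguptaVoight2018.thm2_mordellWeilRank_eq_one_cubeSum_prime_and_sq`
(Dasgupta–Voight, Proc. AMS 146 (2018) Thm. 2; p422669) — the separating witness for the residual
crux A (memo `HOME/bsd-cn100-s2b-c3/SEPARATING-19159.md`; plan g11 05:04:07Z «SEPARATING for
19159»). This file restates it under the REGISTERED stub name with the registered signature and the
fact as its one named hypothesis (planner bsd-cn100-plan, `ledger workitem stub-add
stmt-BirchSwinnertonDyer-19159 --name stub_rung_dvSquare --signature '(hDV :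
DasguptaVoight2018.thm2_mordellWeilRank_eq_one_cubeSum_prime_and_sq) : ∀ ⦃p : ℕ⦄, …'`), so that the
landing is recorded as a proved stub of the crux's skeleton (as `stub_rung_supersingular` p410946 /
`stub_rung_monskyUncovered` p419763). Nothing new is asserted. -/

namespace Summit.BirchSwinnertonDyer.BirchSwinnertonDyer.Theorems.MordellShaFreeCutRungDVSquareStub

open Literature.NumberTheory.EllipticCurves

/-- **stub_rung_dvSquare** (BC5 rung of crux A = `RankPosOfThreeSelmerCorankOne`, LANDED form): for
every prime `p ≡ 4, 7 (mod 9)` such that `3` is not a cube modulo `p`, if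
`corank_{ℤ₃} Sel_{3^∞}(E_{−432p⁴}/ℚ) = 1` then the curve `E_{−432p⁴} : y² = x³ − 432 p⁴` (`= x³ + y³ = p²`)
has a rational point of infinite order — granted Dasgupta–Voight 2018 Thm. 2 (`hDV`). Proof:
`MordellShaFreeCutRungDVSquare.rung_dvSquare_pow_four`. [cite: DasguptaVoight2018, Thm. 2 (arXiv:1707.05874 p. 3)] -/
theorem stub_rung_dvSquare
    (hDV : DasguptaVoight2018.thm2_mordellWeilRank_eq_one_cubeSum_prime_and_sq) :
    ∀ ⦃p : ℕ⦄, p.Prime → (p % 9 = 4 ∨ p % 9 = 7) → (¬ ∃ x : ZMod p, x ^ 3 = 3) →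
      (mordellCurve (-(432 * (p : ℚ) ^ 4))).selmerCorank 3 = 1 →
        1 ≤ (mordellCurve (-(432 * (p : ℚ) ^ 4))).mordellWeilRank :=
  MordellShaFreeCutRungDVSquare.rung_dvSquare_pow_four hDV

end Summit.BirchSwinnertonDyer.BirchSwinnertonDyer.Theorems.MordellShaFreeCutRungDVSquareStub
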